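import Mathlib
import HarnessLib
import Summits.ValiantsHypothesis.ValiantsHypothesis.Theorems.KPlusLogSqLawMixedGaugeLoewnerDownward
import Summits.ValiantsHypothesis.ValiantsHypothesis.Theorems.KPlusLogSqLawMixedGaugeUpwardLaw

/-!
# Route «KPlusLogSqLaw», `WeakLifting` (stmt-ValiantsHypothesis-19561) — mixed-gauge series: THE FAMILY DOWNWARD LAW — over ALL
# positive roots together, the kernel directions of NON-POSITIVE type number at most `m` (every exponent pair `a < b`)

HONEST FRAMING.  Helper file (hand leafhand-val-kpluslogsqlaw-1 g14, 2026-08-31; `--supports stmt-ValiantsHypothesis-19561 --as helper`,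
zero crux / stub credit), third of this hand's additions to val-sym-lift-p4 g26's MIXED-GAUGE series (`…MixedGaugeLoewnerDownward`
p833028, `…MixedGaugeTwoClassGeneralRatio` p833259).  Object: the two-class mixed vertex gauge
`M(x) = [[A + x^a·1ₙ, B], [Bᵀ, C − x^b·1ₘ]]` (`A ∈ Sym(n)`, `C ∈ Sym(m)`, `B` any real `n × m`, `1 ≤ a < b`).  The downward law of
the series (`MixedGauge.down_card_le_blocks_rpow`: at most `m` DISTINCT downward positive zeros, one kernel vector each) is
strengthened here to FAMILIES: at finitely many distinct positive roots `x_t` take, at each, a kernel family of `M(x_t)`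
(any size) which is linearly independent and on whose SPAN the kernel form `uᵀM′(x_t)u` is non-positive
(`a x^a‖w(u)‖² ≤ b x^b‖q(u)‖²`); then the TOTAL number of vectors is at most `m` (`family_card_le_blocks`,
abstract form `family_down_card_le` for every real exponent `0 < p < 1`).  PROOF: a dependency `Σ cⱼqⱼ = 0` among more than `m`
fast components; aggregate per root (`W_t = Σ_{j at t} cⱼwⱼ`, `Q_t = Σ_{j at t} cⱼqⱼ`): the block two-point identities are
bilinear, so the aggregates at DISTINCT roots satisfy them, and `0 = ‖Σ_t Q_t‖²` expands into the (strictly positive definite,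
p833028 `loewnerForm_pos`) Loewner form of `y ↦ yᵖ` at the nodes `Y_t = x_t^b` applied coordinatewise to `(W_t)_t`, plus the
non-negative excesses `‖Q_t‖² − p Y_tᵖ⁻¹‖W_t‖²`; hence every `W_t = 0`, then every `Q_t = 0`, and independence at each root kills `c`.
WHY (located, not claimed here): this is the first half of a proof of the series' LOCATED law `ζ ≤ n + 2m` AT EVERY RATIO — with
`π_t` the positive index of the kernel form at the root `x_t`, this file gives `Σ_t (dim ker M(x_t) − π_t) ≤ m`, while the tree's
inertia kit (`Inertia.eventually_negIndex_ge_add_left` / `eventually_posIndex_ge_add_right`, the index telescope) gives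
`Σ_t π_t ≤ ν(M(0⁺)) − ν(M(+∞)) + Σ_t (dim ker − π_t) ≤ n + m`; together `Σ_t dim ker M(x_t) ≤ n + 2m` (sequel).  Nothing here is
about `WeakLifting` / `TropicalB` in their windows, the registered stubs of `tower_graft.lean`, the doors, `MatrixDescartes` (18050)
or VP ≠ VNP.  No `def`; axioms standard.  [folklore linear algebra over the Loewner kernel (Löwner 1934 / Heinz 1951)]
-/

set_option linter.dupNamespace false
set_option autoImplicit false

namespace Summit.ValiantsHypothesis.ValiantsHypothesis.Theorems.KPlusLogSqLaw

namespace MixedGauge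

open MeasureTheory Set Filter Real Matrix Finset
open scoped Topology BigOperators
open Summit.ValiantsHypothesis.ValiantsHypothesis.Theorems.KPlusLogSqLaw.TowerGraft.TwoSidedThree.Loewner

variable {n m : ℕ}

/-! ## 1. The abstract family downward law at every exponent `0 < p < 1` -/

/-- **FAMILY DOWNWARD LAW, every exponent.**  Distinct positive nodes `Y_t` (`t < T`), a finite index set `J` of vectors
`(wⱼ, qⱼ) ∈ ℝⁿ × ℝᵐ` each attached to a node `root j`, such that: (i) across DIFFERENT nodes the two-point identities
`(Y_{t'}ᵖ − Y_tᵖ)⟪wⱼ,wⱼ'⟫ = (Y_{t'} − Y_t)⟪qⱼ,qⱼ'⟫` hold; (ii) at each node the attached family is DOWNWARD ON ITS SPAN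
(`p·Y_tᵖ⁻¹·‖Σ cⱼwⱼ‖² ≤ ‖Σ cⱼqⱼ‖²` for all coefficients); (iii) at each node the attached pairs `(wⱼ, qⱼ)` are linearly independent
(jointly over the nodes: vanishing of all per-node aggregates forces `c = 0`).  Then `#J ≤ m`. [folklore] -/
theorem family_down_card_le {T : ℕ} {J : Type} [Fintype J] [DecidableEq J] (p : ℝ) (hp : p ∈ Set.Ioo (0:ℝ) 1)
    (Y : Fin T → ℝ) (hY : ∀ t, 0 < Y t) (hinj : Function.Injective Y) (root : J → Fin T)
    (w : J → (Fin n → ℝ)) (q : J → (Fin m → ℝ))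
    (hid : ∀ j j', root j ≠ root j' →
      (Y (root j') ^ p - Y (root j) ^ p) * (w j ⬝ᵥ w j') = (Y (root j') - Y (root j)) * (q j ⬝ᵥ q j'))
    (hdown : ∀ (t : Fin T) (c : J → ℝ),
      p * Y t ^ (p - 1) * ((∑ j ∈ univ.filter (fun j => root j = t), c j • w j) ⬝ᵥ
          (∑ j ∈ univ.filter (fun j => root j = t), c j • w j))
        ≤ (∑ j ∈ univ.filter (fun j => root j = t), c j • q j) ⬝ᵥ
          (∑ j ∈ univ.filter (fun j => root j = t), c j • q j))
    (hli : ∀ c : J → ℝ, (∀ t, ∑ j ∈ univ.filter (fun j => root j = t), c j • w j = 0) →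
      (∀ t, ∑ j ∈ univ.filter (fun j => root j = t), c j • q j = 0) → c = 0) :
    Fintype.card J ≤ m := by
  classical
  by_contra hlt
  push Not at hlt
  -- a dependency among the fast components
  let f : (J → ℝ) →ₗ[ℝ] (Fin m → ℝ) :=
    { toFun := fun d => ∑ j, d j • q j
      map_add' := by
        intro d d'
        simp only [Pi.add_apply, add_smul, Finset.sum_add_distrib]
      map_smul' := by
        intro r d
        simp only [Pi.smul_apply, smul_eq_mul, mul_smul, ← Finset.smul_sum, RingHom.id_apply] }
  have hker : LinearMap.ker f ≠ ⊥ := by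
    apply LinearMap.ker_ne_bot_of_finrank_lt
    rw [Module.finrank_fintype_fun_eq_card, Module.finrank_fintype_fun_eq_card, Fintype.card_fin]
    exact hlt
  obtain ⟨c, hcker, hc0⟩ := (Submodule.ne_bot_iff _).mp hker
  have hsumq : ∑ j, c j • q j = 0 := LinearMap.mem_ker.mp hcker
  -- per-node aggregates
  set W : Fin T → (Fin n → ℝ) := fun t => ∑ j ∈ univ.filter (fun j => root j = t), c j • w j with hWdef
  set Q : Fin T → (Fin m → ℝ) := fun t => ∑ j ∈ univ.filter (fun j => root j = t), c j • q j with hQdef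
  have hQsum : ∑ t, Q t = 0 := by
    simp only [hQdef]
    rw [Finset.sum_fiberwise univ root (fun j => c j • q j)]
    exact hsumq
  -- the two-point identities pass to the aggregates at distinct nodes (bilinearity)
  have hidW : ∀ t t', t ≠ t' → (Y t' ^ p - Y t ^ p) * (W t ⬝ᵥ W t') = (Y t' - Y t) * (Q t ⬝ᵥ Q t') := by
    intro t t' htt'
    simp only [hWdef, hQdef]
    rw [sum_dotProduct, sum_dotProduct, Finset.mul_sum, Finset.mul_sum]
    refine Finset.sum_congr rfl fun j hj => ?_
    rw [dotProduct_sum, dotProduct_sum, Finset.mul_sum, Finset.mul_sum]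
    refine Finset.sum_congr rfl fun j' hj' => ?_
    have hrj : root j = t := (Finset.mem_filter.mp hj).2
    have hrj' : root j' = t' := (Finset.mem_filter.mp hj').2
    have hne : root j ≠ root j' := by rw [hrj, hrj']; exact htt'
    have h := hid j j' hne
    rw [hrj, hrj'] at h
    rw [smul_dotProduct, dotProduct_smul, smul_dotProduct, dotProduct_smul, smul_eq_mul, smul_eq_mul, smul_eq_mul,
      smul_eq_mul]
    linear_combination (c j * c j') * h
  have hdownW : ∀ t, p * Y t ^ (p - 1) * (W t ⬝ᵥ W t) ≤ Q t ⬝ᵥ Q t := fun t => hdown t c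
  -- the normalised Loewner kernel at the nodes
  set c₀ : ℝ := ∫ x in Ioi 0, rpowIntegrand₀₁ p x 1 with hc₀def
  have hc₀ : 0 < c₀ := integral_rpowIntegrand₀₁_one_pos hp
  set L : Fin T → Fin T → ℝ :=
    fun t t' => c₀⁻¹ * ∫ x in Ioi 0, x ^ p / ((x + Y t) * (x + Y t')) with hLdef
  have hLdiag : ∀ t, L t t = p * Y t ^ (p - 1) := by
    intro t
    simp only [hLdef]
    rw [integral_kernel_diag p (Y t) hp (hY t), ← hc₀def, ← mul_assoc, inv_mul_cancel₀ (ne_of_gt hc₀), one_mul]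
  have hLoff : ∀ t t', t ≠ t' → Q t ⬝ᵥ Q t' = L t t' * (W t ⬝ᵥ W t') := by
    intro t t' htt'
    have hne : Y t - Y t' ≠ 0 := sub_ne_zero.mpr (fun h => htt' (hinj h))
    have hK := integral_kernel_mul_sub p (Y t) (Y t') hp (hY t) (hY t')
    rw [← hc₀def] at hK
    have h := hidW t t' htt'
    have hL : L t t' * (Y t - Y t') = Y t ^ p - Y t' ^ p := by
      simp only [hLdef]
      rw [mul_assoc, hK, ← mul_assoc, inv_mul_cancel₀ (ne_of_gt hc₀), one_mul]
    have h2 : (Y t - Y t') * (Q t ⬝ᵥ Q t') = (Y t - Y t') * (L t t' * (W t ⬝ᵥ W t')) := by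
      have : (Y t - Y t') * (Q t ⬝ᵥ Q t') = (Y t ^ p - Y t' ^ p) * (W t ⬝ᵥ W t') := by linear_combination h
      rw [this, ← hL]; ring
    exact mul_left_cancel₀ hne h2
  have hLpos : ∀ x : Fin T → ℝ, x ≠ 0 → 0 < ∑ t, ∑ t', x t * L t t' * x t' := by
    intro x hx
    have h := loewnerForm_pos p hp Y x hY hinj hx
    have heq : ∑ t, ∑ t', x t * L t t' * x t'
        = c₀⁻¹ * ∑ t, ∑ t', x t * (∫ s in Ioi 0, s ^ p / ((s + Y t) * (s + Y t'))) * x t' := by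
      rw [Finset.mul_sum]
      refine Finset.sum_congr rfl fun t _ => ?_
      rw [Finset.mul_sum]
      refine Finset.sum_congr rfl fun t' _ => ?_
      simp only [hLdef]; ring
    rw [heq]
    exact mul_pos (inv_pos.mpr hc₀) h
  have hLnn : ∀ x : Fin T → ℝ, 0 ≤ ∑ t, ∑ t', x t * L t t' * x t' := by
    intro x
    by_cases hx : x = 0
    · subst hx; simp
    · exact le_of_lt (hLpos x hx)
  -- expand 0 = ‖Σ_t Q_t‖²
  have hzero : (∑ t, Q t) ⬝ᵥ (∑ t', Q t') = 0 := by rw [hQsum, dotProduct_zero]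
  have hexp : (∑ t, Q t) ⬝ᵥ (∑ t', Q t') = ∑ t, ∑ t', Q t ⬝ᵥ Q t' := by
    rw [sum_dotProduct]
    refine Finset.sum_congr rfl fun t _ => ?_
    rw [dotProduct_sum]
  have hterm : ∀ t t', Q t ⬝ᵥ Q t' =
      (∑ i, W t i * L t t' * W t' i)
        + (if t = t' then (Q t ⬝ᵥ Q t - p * Y t ^ (p - 1) * (W t ⬝ᵥ W t)) else 0) := by
    intro t t'
    have hsum : ∑ i, W t i * L t t' * W t' i = L t t' * (W t ⬝ᵥ W t') := by
      rw [dotProduct, Finset.mul_sum]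
      refine Finset.sum_congr rfl fun i _ => ?_
      ring
    rw [hsum]
    by_cases htt' : t = t'
    · subst htt'
      rw [if_pos rfl, hLdiag t]
      ring
    · rw [if_neg htt', add_zero, hLoff t t' htt']
  have hdouble : ∑ t, ∑ t', Q t ⬝ᵥ Q t' =
      (∑ t, ∑ t', ∑ i, W t i * L t t' * W t' i)
        + ∑ t, (Q t ⬝ᵥ Q t - p * Y t ^ (p - 1) * (W t ⬝ᵥ W t)) := by
    rw [Finset.sum_congr rfl fun t _ => Finset.sum_congr rfl fun t' _ => hterm t t']
    rw [← Finset.sum_add_distrib]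
    refine Finset.sum_congr rfl fun t _ => ?_
    rw [Finset.sum_add_distrib, Finset.sum_ite_eq, if_pos (Finset.mem_univ _)]
  have hcomm : ∑ t, ∑ t', ∑ i, W t i * L t t' * W t' i = ∑ i, ∑ t, ∑ t', W t i * L t t' * W t' i := by
    calc (∑ t, ∑ t', ∑ i, W t i * L t t' * W t' i)
        = ∑ t, ∑ i, ∑ t', W t i * L t t' * W t' i := Finset.sum_congr rfl fun t _ => Finset.sum_comm
      _ = ∑ i, ∑ t, ∑ t', W t i * L t t' * W t' i := Finset.sum_comm
  have hKi : ∀ i, 0 ≤ ∑ t, ∑ t', W t i * L t t' * W t' i := fun i => hLnn (fun t => W t i)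
  have hA : 0 ≤ ∑ t, ∑ t', ∑ i, W t i * L t t' * W t' i := by
    rw [hcomm]; exact Finset.sum_nonneg fun i _ => hKi i
  have hexcess : ∀ t, 0 ≤ Q t ⬝ᵥ Q t - p * Y t ^ (p - 1) * (W t ⬝ᵥ W t) := fun t => by linarith [hdownW t]
  have hB : 0 ≤ ∑ t, (Q t ⬝ᵥ Q t - p * Y t ^ (p - 1) * (W t ⬝ᵥ W t)) := Finset.sum_nonneg fun t _ => hexcess t
  rw [hexp, hdouble] at hzero
  have hA0 : ∑ t, ∑ t', ∑ i, W t i * L t t' * W t' i = 0 := by linarith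
  have hB0 : ∑ t, (Q t ⬝ᵥ Q t - p * Y t ^ (p - 1) * (W t ⬝ᵥ W t)) = 0 := by linarith
  -- every aggregate W_t vanishes
  have hW0 : ∀ t, W t = 0 := by
    intro t
    funext i
    rw [hcomm] at hA0
    have hi0 := (Finset.sum_eq_zero_iff_of_nonneg fun i _ => hKi i).mp hA0 i (Finset.mem_univ _)
    by_contra hne
    have hci : (fun t => W t i) ≠ 0 := fun h => hne (congrFun h t)
    have := hLpos (fun t => W t i) hci
    linarith
  -- then every aggregate Q_t vanishes
  have hQ0 : ∀ t, Q t = 0 := by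
    intro t
    have hBt := (Finset.sum_eq_zero_iff_of_nonneg fun t _ => hexcess t).mp hB0 t (Finset.mem_univ _)
    rw [hW0 t, dotProduct_zero, mul_zero, sub_zero] at hBt
    exact dotProduct_self_eq_zero.mp hBt
  -- independence at each node kills the dependency
  exact hc0 (hli c (fun t => hW0 t) (fun t => hQ0 t))

/-! ## 2. Pencil currency: kernel families of non-positive type at distinct positive roots number at most `m` -/

/-- **FAMILY DOWNWARD LAW for the block pencil `[[A + X^a·1, B], [Bᵀ, C − X^b·1]]`, `1 ≤ a < b`.**  At distinct positive points
`x_t` (`t < T`) take kernel vectors `(wⱼ, qⱼ)` of `M(x_{root j})` (a finite family `J`, each attached to one point) such that at each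
point the attached family is linearly independent (vanishing aggregates force `c = 0`) and of NON-POSITIVE TYPE ON ITS SPAN:
`a·x^a·‖Σ cⱼwⱼ‖² ≤ b·x^b·‖Σ cⱼqⱼ‖²` (the kernel form `uᵀM′(x)u ≤ 0`).  Then `#J ≤ m`: e.g. the dimensions of maximal non-positive
subspaces of the kernel forms, summed over all positive roots, are at most `m`. [folklore] -/
theorem family_card_le_blocks {T : ℕ} {J : Type} [Fintype J] [DecidableEq J]
    (A : Matrix (Fin n) (Fin n) ℝ) (hA : A.IsSymm) (C : Matrix (Fin m) (Fin m) ℝ) (hC : C.IsSymm)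
    (B : Matrix (Fin n) (Fin m) ℝ) (a b : ℕ) (ha : 1 ≤ a) (hab : a < b)
    (x : Fin T → ℝ) (hx : ∀ t, 0 < x t) (hinj : Function.Injective x) (root : J → Fin T)
    (w : J → (Fin n → ℝ)) (q : J → (Fin m → ℝ))
    (hker : ∀ j, (A + (x (root j) ^ a) • (1 : Matrix (Fin n) (Fin n) ℝ)) *ᵥ w j + B *ᵥ q j = 0 ∧
      Bᵀ *ᵥ w j + (C - (x (root j) ^ b) • (1 : Matrix (Fin m) (Fin m) ℝ)) *ᵥ q j = 0)
    (hdown : ∀ (t : Fin T) (c : J → ℝ),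
      (a : ℝ) * x t ^ a * ((∑ j ∈ univ.filter (fun j => root j = t), c j • w j) ⬝ᵥ
          (∑ j ∈ univ.filter (fun j => root j = t), c j • w j))
        ≤ (b : ℝ) * x t ^ b * ((∑ j ∈ univ.filter (fun j => root j = t), c j • q j) ⬝ᵥ
          (∑ j ∈ univ.filter (fun j => root j = t), c j • q j)))
    (hli : ∀ c : J → ℝ, (∀ t, ∑ j ∈ univ.filter (fun j => root j = t), c j • w j = 0) →
      (∀ t, ∑ j ∈ univ.filter (fun j => root j = t), c j • q j = 0) → c = 0) :
    Fintype.card J ≤ m := by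
  have hb0 : b ≠ 0 := by omega
  have hbpos : (0 : ℝ) < b := by exact_mod_cast (show 0 < b by omega)
  set p : ℝ := (a : ℝ) / b with hpdef
  have hp : p ∈ Set.Ioo (0 : ℝ) 1 := by
    refine ⟨div_pos (by exact_mod_cast (show 0 < a by omega)) hbpos, ?_⟩
    rw [hpdef, div_lt_one hbpos]
    exact_mod_cast hab
  -- nodes Y = x^b: Y^p = x^a, p Y^(p-1) = (a/b) x^a / x^b
  have hYp : ∀ t, (x t ^ b) ^ p = x t ^ a := fun t => by
    rw [hpdef, pow_rpow_div_natCast (hx t) a b hb0]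
  have hYp1 : ∀ t, p * (x t ^ b) ^ (p - 1) = (a : ℝ) / b * (x t ^ a / x t ^ b) := fun t => by
    rw [hpdef, pow_rpow_div_natCast_sub_one (hx t) a b hb0]
  refine family_down_card_le (n := n) (m := m) p hp (fun t => x t ^ b) (fun t => pow_pos (hx t) b) ?_ root w q ?_ ?_ hli
  · intro t t' h
    exact hinj ((pow_left_inj₀ (hx t).le (hx t').le hb0).mp h)
  · intro j j' hjj'
    simp only [hYp]
    exact two_point_blocks A hA C hC B (x (root j) ^ a) (x (root j) ^ b) (x (root j') ^ a) (x (root j') ^ b)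
      (w j) (w j') (q j) (q j') (hker j).1 (hker j).2 (hker j').1 (hker j').2
  · intro t c
    simp only [hYp1]
    have hxa : 0 < x t ^ a := pow_pos (hx t) a
    have hxb : 0 < x t ^ b := pow_pos (hx t) b
    have h := hdown t c
    -- (a/b)(x^a/x^b)·‖W‖² ≤ ‖Q‖²  ⟸  a x^a ‖W‖² ≤ b x^b ‖Q‖²
    have hWnn : 0 ≤ (∑ j ∈ univ.filter (fun j => root j = t), c j • w j) ⬝ᵥ
        (∑ j ∈ univ.filter (fun j => root j = t), c j • w j) := by
      rw [dotProduct]; exact Finset.sum_nonneg fun i _ => mul_self_nonneg _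
    rw [show (a : ℝ) / b * (x t ^ a / x t ^ b) = ((a : ℝ) * x t ^ a) / ((b : ℝ) * x t ^ b) by
      field_simp]
    rw [div_mul_eq_mul_div, div_le_iff₀ (by positivity)]
    linarith [h]

end MixedGauge

end Summit.ValiantsHypothesis.ValiantsHypothesis.Theorems.KPlusLogSqLaw
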